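import Literature.MathematicalPhysics.QuantumFieldTheory.Balaban1983to89.T4ExpWindowSmallField
import HarnessLib

/-!
# A FUNDAMENTAL DOMAIN for the exponential chart of `SU(2)`: `expPoint` is a BIJECTION from `ball 0 π ∪ {π·e₀}` onto `SU(2)`
# (injectivity input for localising the chart identity on the tree-gauged ring space — layer (B2) of the DIRECT Laplace road to
# ⟨stmt-QuantumFields-24204⟩ `VirialFluxGap.SharpTwistedLaplace`)

Helper module (free-hands work of width seat ym-line-sfw-p2-w3 g57, cell ym-idea-1; `--supports 24204`).  The exponential chart
`expPoint : ℝ³ → SU(2)` (✓`T4HaarSU2ExpChart`) is injective on the open ball of radius `π` (✓`injOn_expPoint`) and onto from the closed ball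
(✓`image_expPoint_closedBall`), the whole sphere `‖b‖ = π` being mapped to `−1`.  Hence the Borel set `D = ball 0 π ∪ {π·e₀}` is a FUNDAMENTAL
DOMAIN: `expPoint` restricted to `D` is a bijection onto `SU(2)` (`injOn_expPoint_domain`, `image_expPoint_domain`, `surjOn_conj_expPoint_domain`),
and `D` differs from the ball by one point (so the chart law `expMeasure` gives it full measure: `measurableSet_expDomain`, `ball_subset_expDomain`).
USE: in ✓`ChartTensor.restrict_image_tensorWindow_eq_map_withDensity` the rest window `B₂ = Π D` is simultaneously ONTO (hypothesis `hsurj`) and an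
injectivity domain, so the resulting chart identity on `X_fix` (✓`FixSplit.fix_restrict_image_windowMap` pattern) can be localised to the Laplace
window by ✓`Literature.Analysis.Asymptotics.chart_restrict_of_injOn_ofReal`.
Everything here is PROVED; no definitions, no named facts (namespace `Summit.QuantumFields.YangMills.Theorems.VirialFluxGap.ConjChart`).
HONEST FRAMING: elementary; ⟨24204⟩, ⟨24319⟩ and every rung stay OPEN; the Yang–Mills mass gap (Clay) is NOT touched; no summit is proved by a line.

## References
* S. Helgason, *Groups and Geometric Analysis* (2000), Ch. I §1 (exponential coordinates). [Helgason2000]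
-/

set_option autoImplicit false

noncomputable section

open Set Metric NormedSpace
open scoped Quaternion
open Literature.MathematicalPhysics.QuantumLattice
open Literature.MathematicalPhysics.QuantumFieldTheory.Balaban1983to89.T4HaarSU2ExpChart
open Literature.MathematicalPhysics.QuantumFieldTheory.Balaban1983to89.T4ExpWindowSmallField

namespace Summit.QuantumFields.YangMills.Theorems.VirialFluxGap.ConjChart

/-- On the sphere of radius `π` the chart is constant: `exp(ι b) = −1` for `‖b‖ = π`. [folklore] -/
theorem exp_imQuat_of_norm_eq_pi {b : EuclideanSpace ℝ (Fin 3)} (hb : ‖b‖ = Real.pi) : exp (imQuat b) = -1 := by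
  rw [exp_imQuat, hb, Real.cos_pi, Real.sinc_of_ne_zero Real.pi_ne_zero, Real.sin_pi, zero_div, zero_smul, add_zero]
  norm_num

/-- `expPoint b = expPoint b'` whenever `‖b‖ = ‖b'‖ = π`. [folklore] -/
theorem expPoint_eq_of_norm_eq_pi {b b' : EuclideanSpace ℝ (Fin 3)} (hb : ‖b‖ = Real.pi) (hb' : ‖b'‖ = Real.pi) : expPoint b = expPoint b' := by
  unfold expPoint
  rw [exp_imQuat_of_norm_eq_pi hb, exp_imQuat_of_norm_eq_pi hb']

/-- Inside the open ball the chart never reaches `−1` (real part `cos ‖b‖ > −1`). [folklore] -/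
theorem exp_imQuat_ne_neg_one {b : EuclideanSpace ℝ (Fin 3)} (hb : ‖b‖ < Real.pi) : exp (imQuat b) ≠ -1 := by
  intro h
  have h1 := congrArg (fun q : ℍ => q.re) h
  simp only [exp_imQuat_re, Quaternion.re_neg, Quaternion.re_one] at h1
  have h2 : -1 < Real.cos ‖b‖ := by
    have := Real.cos_lt_cos_of_nonneg_of_le_pi (norm_nonneg b) le_rfl hb
    rwa [Real.cos_pi] at this
  linarith

/-- The pole of the fundamental domain: `π·e₀` has norm `π`. [folklore] -/
theorem norm_pi_smul_single : ‖(Real.pi : ℝ) • (EuclideanSpace.single (0 : Fin 3) (1 : ℝ))‖ = Real.pi := by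
  rw [norm_smul, Real.norm_eq_abs, abs_of_pos Real.pi_pos]; simp

/-- The fundamental domain is Borel. [folklore] -/
theorem measurableSet_expDomain :
    MeasurableSet (ball (0 : EuclideanSpace ℝ (Fin 3)) Real.pi ∪ {(Real.pi : ℝ) • EuclideanSpace.single (0 : Fin 3) (1 : ℝ)}) :=
  measurableSet_ball.union (measurableSet_singleton _)

/-- ★ **`expPoint` is injective on the fundamental domain `ball 0 π ∪ {π·e₀}`.** [cite: Helgason2000, Ch. I §1] -/
theorem injOn_expPoint_domain :
    InjOn expPoint (ball (0 : EuclideanSpace ℝ (Fin 3)) Real.pi ∪ {(Real.pi : ℝ) • EuclideanSpace.single (0 : Fin 3) (1 : ℝ)}) := by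
  rintro b (hb | hb) b' (hb' | hb') h
  · exact injOn_expPoint hb hb' h
  · exfalso
    rw [mem_singleton_iff] at hb'
    have h1 : exp (imQuat b) = -1 := by
      rw [← su2Quat_expPoint, h, hb', su2Quat_expPoint, exp_imQuat_of_norm_eq_pi norm_pi_smul_single]
    exact exp_imQuat_ne_neg_one (mem_ball_zero_iff.1 hb) h1
  · exfalso
    rw [mem_singleton_iff] at hb
    have h1 : exp (imQuat b') = -1 := by
      rw [← su2Quat_expPoint, ← h, hb, su2Quat_expPoint, exp_imQuat_of_norm_eq_pi norm_pi_smul_single]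
    exact exp_imQuat_ne_neg_one (mem_ball_zero_iff.1 hb') h1
  · rw [mem_singleton_iff] at hb hb'; rw [hb, hb']

/-- ★ **`expPoint` maps the fundamental domain ONTO `SU(2)`** (closed ball = open ball ∪ sphere, and the sphere goes to `−1 = expPoint(π·e₀)`).
[cite: Helgason2000, Ch. I §1] -/
theorem image_expPoint_domain :
    expPoint '' (ball (0 : EuclideanSpace ℝ (Fin 3)) Real.pi ∪ {(Real.pi : ℝ) • EuclideanSpace.single (0 : Fin 3) (1 : ℝ)}) = univ := by
  refine eq_univ_of_forall fun U => ?_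
  have hU : U ∈ expPoint '' closedBall (0 : EuclideanSpace ℝ (Fin 3)) Real.pi := by rw [image_expPoint_closedBall]; exact mem_univ _
  obtain ⟨b, hb, rfl⟩ := hU
  rcases (mem_closedBall_zero_iff.1 hb).lt_or_eq with h | h
  · exact ⟨b, Or.inl (mem_ball_zero_iff.2 h), rfl⟩
  · exact ⟨(Real.pi : ℝ) • EuclideanSpace.single (0 : Fin 3) (1 : ℝ), Or.inr (mem_singleton _),
      expPoint_eq_of_norm_eq_pi norm_pi_smul_single h⟩

/-- The open chart ball sits inside the fundamental domain. [folklore] -/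
theorem ball_subset_expDomain :
    ball (0 : EuclideanSpace ℝ (Fin 3)) Real.pi ⊆ ball (0 : EuclideanSpace ℝ (Fin 3)) Real.pi ∪ {(Real.pi : ℝ) • EuclideanSpace.single (0 : Fin 3) (1 : ℝ)} :=
  subset_union_left

/-- **The conjugated left chart is a bijection from the fundamental domain**: injective and onto for `b ↦ k·expPoint(b)·R·k⁻¹`. [folklore] -/
theorem injOn_conjChart_domain (k R : Matrix.specialUnitaryGroup (Fin 2) ℂ) :
    InjOn (fun b : EuclideanSpace ℝ (Fin 3) => k * (expPoint b * R) * k⁻¹)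
      (ball (0 : EuclideanSpace ℝ (Fin 3)) Real.pi ∪ {(Real.pi : ℝ) • EuclideanSpace.single (0 : Fin 3) (1 : ℝ)}) := by
  intro b hb b' hb' h
  have h' : expPoint b = expPoint b' := by
    have := congrArg (fun U => k⁻¹ * U * k * R⁻¹) h
    simpa [mul_assoc] using this
  exact injOn_expPoint_domain hb hb' h'

/-- The conjugated left chart maps the fundamental domain onto `SU(2)`. [folklore] -/
theorem surjOn_conjChart_domain (k R : Matrix.specialUnitaryGroup (Fin 2) ℂ) :
    SurjOn (fun b : EuclideanSpace ℝ (Fin 3) => k * (expPoint b * R) * k⁻¹)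
      (ball (0 : EuclideanSpace ℝ (Fin 3)) Real.pi ∪ {(Real.pi : ℝ) • EuclideanSpace.single (0 : Fin 3) (1 : ℝ)}) univ := by
  intro U _
  have hU : k⁻¹ * U * k * R⁻¹ ∈ expPoint '' (ball (0 : EuclideanSpace ℝ (Fin 3)) Real.pi ∪
      {(Real.pi : ℝ) • EuclideanSpace.single (0 : Fin 3) (1 : ℝ)}) := by
    rw [image_expPoint_domain]; exact mem_univ _
  obtain ⟨b, hb, hbU⟩ := hU
  refine ⟨b, hb, ?_⟩
  simp only [hbU]
  group

end Summit.QuantumFields.YangMills.Theorems.VirialFluxGap.ConjChart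

end
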